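import Literature.NumberTheory.EllipticCurves.PAdicLFunctionFrickeSymmetryProofs
import Literature.NumberTheory.EllipticCurves.PAdicLFunctionMinusIntegralityProofs
import Summits.BirchSwinnertonDyer.BirchSwinnertonDyer.Theorems.ByReductionTypeAtTwoRankOneAtTwoOffBigImageOddLocalArchHeckePairing
import HarnessLib

/-!
# Route `ByReductionTypeAtTwo`, crux `RankOneAtTwoOffBigImageOddLocal` (stmt-BirchSwinnertonDyer-23716), line
# `refined_kolyvagin_tamagawa_shift_at_two`, stub `stub_sigmaShiftPosDisc`: THE HALF-SUM OF MINUS MODULAR SYMBOLS AT A PRIME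
# DENOMINATOR — Fricke pairing, numerator-periodicity, and the parity reduction to the «CM cusps» `N s² ≡ ±1 (mod ℓ)` (PROVED, in the
# tree's modular-symbol currency)

Lead prover `prover-cruxlead-stmt-BirchSwinnertonDyer-23716-g12` (2026-08-29), `--supports stmt-BirchSwinnertonDyer-23716` (helper; closes
nothing).  THEOREMS ONLY (no definition, no named fact, no `sorry`).  Companion memo `Cruxes/RankOneAtTwoOffBigImageOddLocal/ArchBoundaryBitAtTwo.md`
v4 §8.3 and `MS-probe-RESULTS.md`; sequel to `…ArchHeckePairing.lean` (p699414).

WHY.  Memo §8: on `{Δ > 0}` the boundary-level archimedean Selmer bit of Kolyvagin's class at `p = 2` is a MINUS MODULAR SYMBOL mod `2`; for the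
children of the principal oval it is `y(s/ℓ)`, `N s² ≡ 1 (mod ℓ)`, and the probe's «pairing» `y(k/ℓ) = y(k′/ℓ)` (`k k′ N ≡ 1`) is — this file makes
it a tree theorem — the Mazur–Tate–Teitelbaum FRICKE SYMMETRY `{∞, u/m}_f = −ε {∞, v/m}_f` (`a m − u N v = 1`) of
`Literature…ModularForms.IsFrickeEigen.modularSymbol_div_eq_neg_mul`, read on the odd parts.  Consequences proved here, for `f ∈ S₂(Γ₀(N))`
pointwise Fricke-eigen with `ε² = 1` and a prime `ℓ ∤ N`:

* §1 `modularSymbol_div_eq_of_fricke_pair` — `{∞, v₁/ℓ} = {∞, v₂/ℓ}` whenever both `v₁, v₂` are Fricke partners of the same `u`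
  (numerator-PERIODICITY mod `ℓ` at denominators prime to `N`, with no appeal to the named fact `modularSymbol_add_intCast`);
* §2 `minusSymbol_div_eq_mul` — `minusSymbol f (k/ℓ) = ε · minusSymbol f (k′/ℓ)` for `a ℓ + k N k′ = 1` (the PAIRING); for `ε = 1` the minus
  symbols, hence the imaginary parts `y`, AGREE on partners `k ↔ (Nk)⁻¹`;
* §3 on `ZMod ℓ`: `W k := minusSymbol f (k.val/ℓ)` is odd (`W (−k) = −W k`), Fricke-paired (`W k = ε W (Nk)⁻¹`), and VANISHES at `N k² = −1`
  when `ε = 1` (`W k = W(−k) = −W k`);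
* §5 CONCRETE FORM (real coefficients): `[k/ℓ]⁻_f ∈ ½ℤ` (tree integrality: the cusp `k/ℓ` is `Γ₀(N)`-equivalent to `0`), and
  `Σ_{k ∈ H} [k/ℓ]⁻_f ≡ Σ_{k ∈ H, N k² = 1} [k/ℓ]⁻_f (mod ℤ)` — the integers `y = 2[·]⁻` of the memo satisfy `H_ℓ ≡ y(s/ℓ)·[(N/ℓ)=+1] (mod 2)`.
* §4 THE HALF-SUM (ε = 1): for every additive `μ` with `2 • μ(W k) = 0` (e.g. `y ↦ y mod 2` once `y` is integral — the lattice facts are NOT used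
  here), `μ (Σ_{1 ≤ k ≤ (ℓ−1)/2} W k) = Σ_{1 ≤ k ≤ (ℓ−1)/2, N k² = 1} μ (W k)`: modulo `2` the half-sum of the minus symbols with denominator `ℓ`
  IS the symbol at the square root of `N⁻¹` — `0` if `(N/ℓ) = −1` (memo §8.3: `H_ℓ ≡ y(s/ℓ)·[(N/ℓ) = +1]`, probe-verified on 37a1/79a1/101a1, all `ℓ < 75`).
  With Birch's formula (named fact `twisted_LValue_eq`, not used here) the left side is `½·√ℓ·L(f ⊗ χ_{−ℓ}, 1)/(Ω⁻/2)` mod 2 for `ℓ ≡ 3 (mod 4)`: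
  the principal case of conjecture MS-even is a statement about `ord₂ L(E^{(−ℓ)}, 1)` (memo §8.3, BSD₂ reading).

BSD is NOT proved by any of this; the crux is NOT proved; the stub is NOT proved; MS-even / A∞′ are NOT proved.

References: [MazurTateTeitelbaum1986Invent] B. Mazur, J. Tate, J. Teitelbaum, Invent. Math. 84 (1986) §I.17 (Fricke functional equation of
modular symbols); [Cremona1997] J. E. Cremona, *Algorithms for modular elliptic curves* (1997) §2.8, §2.11; [Manin1972] Ju. I. Manin, Izv. 36 (1972)
§1 (symbols `{∞, r}`).
-/

set_option linter.dupNamespace false -- tree convention: `Summit.BirchSwinnertonDyer.BirchSwinnertonDyer.Theorems` (summit = sub-problem)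
set_option autoImplicit false

noncomputable section

open scoped MatrixGroups ModularForm

open CongruenceSubgroup Complex Finset
open Literature.NumberTheory.EllipticCurves.ModularForms

namespace Summit.BirchSwinnertonDyer.BirchSwinnertonDyer.Theorems.OffBigImageOddLocalAtTwo.ArchFrickeHalfSum

variable {N : ℕ} [NeZero N] {f : CuspForm (Gamma0 N) 2} {ε : ℂ}

/-! ## §1 Numerator periodicity from the Fricke symmetry -/

/-- `ε² = 1 ⟹ −ε ≠ 0`. [folklore] -/
theorem neg_ne_zero_of_sq_eq_one (hε : ε ^ 2 = 1) : -ε ≠ 0 := by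
  intro h
  rw [neg_eq_zero] at h
  rw [h] at hε
  norm_num at hε

/-- **Numerator periodicity at a denominator prime to `N`**: if `v₁` and `v₂` are both Fricke partners of `u` at denominator `ℓ`
(`a₁ ℓ − u N v₁ = 1 = a₂ ℓ − u N v₂`, so `v₁ ≡ v₂ (mod ℓ)`), then `{∞, v₁/ℓ}_f = {∞, v₂/ℓ}_f` — both equal `−ε⁻¹ {∞, u/ℓ}_f`.
(The tree keeps `{∞, r + n} = {∞, r}` as the named fact `modularSymbol_add_intCast`; at these cusps it is a COROLLARY of the proved Fricke
symmetry.) [cite: MazurTateTeitelbaum1986Invent, §I.17] -/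
theorem modularSymbol_div_eq_of_fricke_pair (hW : IsFrickeEigen N f ε) (hε : ε ^ 2 = 1) {ℓ : ℕ} (hℓ : 0 < ℓ)
    {u v₁ v₂ a₁ a₂ : ℤ} (h₁ : a₁ * ℓ - u * (N * v₁) = 1) (h₂ : a₂ * ℓ - u * (N * v₂) = 1) :
    modularSymbol f ((v₁ : ℚ) / ℓ) = modularSymbol f ((v₂ : ℚ) / ℓ) := by
  have e₁ := hW.modularSymbol_div_eq_neg_mul hε hℓ h₁
  have e₂ := hW.modularSymbol_div_eq_neg_mul hε hℓ h₂
  exact mul_left_cancel₀ (neg_ne_zero_of_sq_eq_one hε) (e₁.symm.trans e₂)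

/-! ## §2 The pairing of minus symbols -/

/-- **THE PAIRING**: for `a ℓ + k N k′ = 1` (i.e. `k′ ≡ (N k)⁻¹ (mod ℓ)`), `minusSymbol f (k/ℓ) = ε · minusSymbol f (k′/ℓ)` — the Fricke
symmetry with `(u, v) = (k, −k′)` and with `(−k, k′)`, combined on the odd parts.  For `ε = 1` (odd analytic rank) the imaginary parts of
`{∞, k/ℓ}` and `{∞, k′/ℓ}` agree: the probe's exact identity `y(k/ℓ) = y(k′/ℓ)` (memo §8.3). [cite: MazurTateTeitelbaum1986Invent, §I.17] -/
theorem minusSymbol_div_eq_mul (hW : IsFrickeEigen N f ε) (hε : ε ^ 2 = 1) {ℓ : ℕ} (hℓ : 0 < ℓ) {a k k' : ℤ}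
    (h : a * ℓ + k * (N * k') = 1) :
    minusSymbol f ((k : ℚ) / ℓ) = ε * minusSymbol f ((k' : ℚ) / ℓ) := by
  have h₁ : a * ℓ - k * (N * (-k')) = 1 := by linear_combination h
  have h₂ : a * ℓ - (-k) * (N * k') = 1 := by linear_combination h
  have e₁ := hW.modularSymbol_div_eq_neg_mul hε hℓ h₁
  have e₂ := hW.modularSymbol_div_eq_neg_mul hε hℓ h₂
  push_cast at e₁ e₂
  rw [neg_div] at e₁ e₂
  simp only [minusSymbol]
  rw [e₁, e₂]
  ring

/-- The plus symbols satisfy the same with the sign `−ε` (tree: `IsFrickeEigen.plusSymbol_div_eq_neg_mul`, rewritten for `v = −k′`):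
`plusSymbol f (k/ℓ) = −ε · plusSymbol f (k′/ℓ)` — for `ε = 1` the real parts are OPPOSITE on partners (`x(k/ℓ) = −x(k′/ℓ)`).
[cite: MazurTateTeitelbaum1986Invent, §I.17] -/
theorem plusSymbol_div_eq_neg_mul' (hW : IsFrickeEigen N f ε) (hε : ε ^ 2 = 1) {ℓ : ℕ} (hℓ : 0 < ℓ) {a k k' : ℤ}
    (h : a * ℓ + k * (N * k') = 1) :
    plusSymbol f ((k : ℚ) / ℓ) = -ε * plusSymbol f ((k' : ℚ) / ℓ) := by
  have h₁ : a * ℓ - k * (N * (-k')) = 1 := by linear_combination h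
  have e₁ := hW.plusSymbol_div_eq_neg_mul hε hℓ h₁
  push_cast at e₁
  rw [neg_div] at e₁
  rw [e₁]
  simp only [plusSymbol, neg_neg]
  ring

/-! ## §3 The symbols on `ZMod ℓ` -/

section ZModFacts

variable {ℓ : ℕ} [Fact ℓ.Prime]

/-- An integer witness of `k · N · k′ ≡ 1 (mod ℓ)`: `∃ a, a ℓ + k.val · N · k′.val = 1`. [folklore] -/
theorem exists_int_rel {N' : ℕ} {k k' : ZMod ℓ} (h : k * (N' : ZMod ℓ) * k' = 1) :
    ∃ a : ℤ, a * (ℓ : ℤ) + (k.val : ℤ) * ((N' : ℤ) * (k'.val : ℤ)) = 1 := by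
  have h0 : ((1 - (k.val : ℤ) * ((N' : ℤ) * (k'.val : ℤ)) : ℤ) : ZMod ℓ) = 0 := by
    push_cast
    rw [ZMod.natCast_zmod_val, ZMod.natCast_zmod_val, ← mul_assoc, h, sub_self]
  obtain ⟨c, hc⟩ := (ZMod.intCast_zmod_eq_zero_iff_dvd _ ℓ).mp h0
  exact ⟨c, by linear_combination -hc⟩

end ZModFacts

section OnZMod

variable {ℓ : ℕ} [Fact ℓ.Prime]

/-- **Fricke pairing on `ZMod ℓ`** (`ℓ ∤ N` prime): for `k ≠ 0`, `minusSymbol f (k.val/ℓ) = ε · minusSymbol f (((N k)⁻¹).val/ℓ)`.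
[cite: MazurTateTeitelbaum1986Invent, §I.17] -/
theorem minusSymbol_val_eq_mul_inv (hW : IsFrickeEigen N f ε) (hε : ε ^ 2 = 1) (hN : (N : ZMod ℓ) ≠ 0) {k : ZMod ℓ}
    (hk : k ≠ 0) :
    minusSymbol f ((k.val : ℚ) / ℓ) = ε * minusSymbol f (((((N : ZMod ℓ) * k)⁻¹).val : ℚ) / ℓ) := by
  have hrel : k * (N : ZMod ℓ) * ((N : ZMod ℓ) * k)⁻¹ = 1 := by
    rw [mul_comm k, mul_inv_cancel₀ (mul_ne_zero hN hk)]
  obtain ⟨a, ha⟩ := exists_int_rel hrel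
  have hℓ : 0 < ℓ := (Fact.out : ℓ.Prime).pos
  have := minusSymbol_div_eq_mul hW hε hℓ ha
  push_cast at this
  exact this

/-- **Oddness on `ZMod ℓ`** (`ℓ ∤ N` prime): for `k ≠ 0`, `minusSymbol f ((−k).val/ℓ) = −minusSymbol f (k.val/ℓ)` — the numerator
periodicity `{∞, (ℓ − k)/ℓ} = {∞, −k/ℓ}`, `{∞, (k − ℓ)/ℓ} = {∞, k/ℓ}` of §1 plus the oddness of `minusSymbol`.
[cite: MazurTateTeitelbaum1986Invent, §I.17] -/
theorem minusSymbol_neg_val (hW : IsFrickeEigen N f ε) (hε : ε ^ 2 = 1) (hN : (N : ZMod ℓ) ≠ 0) {k : ZMod ℓ} (hk : k ≠ 0) :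
    minusSymbol f (((-k).val : ℚ) / ℓ) = -minusSymbol f ((k.val : ℚ) / ℓ) := by
  have hℓ : 0 < ℓ := (Fact.out : ℓ.Prime).pos
  -- u := ((N k)⁻¹).val pairs with v₁ = -k.val and with v₂ = ℓ - k.val = (-k).val
  set u : ZMod ℓ := ((N : ZMod ℓ) * k)⁻¹ with hu
  have hrel : u * (N : ZMod ℓ) * k = 1 := by
    rw [hu, mul_assoc, inv_mul_cancel₀ (mul_ne_zero hN hk)]
  obtain ⟨a, ha⟩ := exists_int_rel hrel
  -- ha : a ℓ + u.val (N k.val) = 1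
  have h₁ : a * ℓ - (u.val : ℤ) * (N * (-(k.val : ℤ))) = 1 := by linear_combination ha
  have h₂ : (a + (u.val : ℤ) * N) * ℓ - (u.val : ℤ) * (N * ((ℓ : ℤ) - (k.val : ℤ))) = 1 := by linear_combination ha
  have h₃ : (a + (u.val : ℤ) * N) * ℓ - (-(u.val : ℤ)) * (N * ((k.val : ℤ) - (ℓ : ℤ))) = 1 := by linear_combination ha
  have h₄ : a * ℓ - (-(u.val : ℤ)) * (N * (k.val : ℤ)) = 1 := by linear_combination ha
  have p₁ := modularSymbol_div_eq_of_fricke_pair hW hε hℓ h₂ h₁   -- {∞,(ℓ-k)/ℓ} = {∞, -k/ℓ}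
  have p₂ := modularSymbol_div_eq_of_fricke_pair hW hε hℓ h₃ h₄   -- {∞,(k-ℓ)/ℓ} = {∞, k/ℓ}
  haveI : NeZero ℓ := ⟨(Fact.out : ℓ.Prime).ne_zero⟩
  have hv : (((-k).val : ℕ) : ℚ) = (ℓ : ℚ) - (k.val : ℚ) := by
    rw [ZMod.neg_val, if_neg hk, Nat.cast_sub (ZMod.val_lt k).le]
  rw [hv]
  simp only [minusSymbol]
  push_cast at p₁ p₂ ⊢
  rw [show -(((ℓ : ℚ) - (k.val : ℚ)) / (ℓ : ℚ)) = ((k.val : ℚ) - (ℓ : ℚ)) / (ℓ : ℚ) by ring, p₁, p₂, neg_div]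
  ring

/-- **Vanishing at the `(−N)`-fixed points** (`ε = 1`): if `N k² = −1` then `minusSymbol f (k.val/ℓ) = 0` — the partner `(Nk)⁻¹` of `k`
is `−k`, so the symbol equals its own negative.  (Hence when `(N/ℓ) = −1` but `(−N/ℓ) = +1` the fixed class contributes nothing.)
[cite: MazurTateTeitelbaum1986Invent, §I.17] -/
theorem minusSymbol_val_eq_zero_of_sq (hW : IsFrickeEigen N f 1) (hN : (N : ZMod ℓ) ≠ 0) {k : ZMod ℓ} (hk : k ≠ 0)
    (hsq : (N : ZMod ℓ) * k * k = -1) :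
    minusSymbol f ((k.val : ℚ) / ℓ) = 0 := by
  have hinv : ((N : ZMod ℓ) * k)⁻¹ = -k := by
    refine inv_eq_of_mul_eq_one_right ?_
    linear_combination -hsq
  have h := minusSymbol_val_eq_mul_inv hW (by norm_num) hN hk
  rw [one_mul, hinv, minusSymbol_neg_val hW (by norm_num) hN hk] at h
  -- h : W k = -W k
  have : (2 : ℂ) * minusSymbol f ((k.val : ℚ) / ℓ) = 0 := by linear_combination h
  simpa using this

end OnZMod

/-! ## §4 The half-sum modulo `2` -/

section HalfSum

variable {ℓ : ℕ} [Fact ℓ.Prime]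

/-- **THE HALF-SUM OF MINUS SYMBOLS AT A PRIME DENOMINATOR, MOD 2** (`ε = 1`, `ℓ ∤ N` an odd prime).  Let `H = {k ∈ ZMod ℓ : 1 ≤ k.val ≤ (ℓ−1)/2}`
and `W k = minusSymbol f (k.val/ℓ)`.  For every additive `μ : ℂ → B` with `2 • μ (W k) = 0` for all `k`:
`μ (Σ_{k ∈ H} W k) = Σ_{k ∈ H, N k² = 1} μ (W k)`.
Proof: `k ↦ ±(Nk)⁻¹` (the sign placing it in `H`) is an involution of `H` on whose orbits `μ ∘ W` is constant (§2–§3); its fixed points are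
`N k² = ±1`, and at `N k² = −1` the symbol vanishes (§3); pairs contribute `2 • μ = 0` (`ArchHeckePairing.sum_eq_sum_fixed`).  So modulo `2` the
half-sum IS the minus symbol at `s`, `N s² ≡ 1` — zero when `(N/ℓ) = −1` (memo §8.3; the boundary-level archimedean bit of the principal oval's
`T_ℓ`-children). [cite: MazurTateTeitelbaum1986Invent, §I.17] [cite: Cremona1997, §2.8] -/
theorem halfSum_eq_sum_sq (hW : IsFrickeEigen N f 1) (hN : (N : ZMod ℓ) ≠ 0) (hℓ2 : ℓ ≠ 2) {B : Type*} [AddCommGroup B]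
    (μ : ℂ →+ B) (hμ : ∀ k : ZMod ℓ, 2 • μ (minusSymbol f ((k.val : ℚ) / ℓ)) = 0) :
    μ (∑ k ∈ (univ : Finset (ZMod ℓ)).filter (fun k ↦ 1 ≤ k.val ∧ k.val ≤ (ℓ - 1) / 2), minusSymbol f ((k.val : ℚ) / ℓ)) =
      ∑ k ∈ ((univ : Finset (ZMod ℓ)).filter (fun k ↦ 1 ≤ k.val ∧ k.val ≤ (ℓ - 1) / 2)).filter
          (fun k ↦ (N : ZMod ℓ) * k * k = 1), μ (minusSymbol f ((k.val : ℚ) / ℓ)) := by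
  classical
  have hℓp : ℓ.Prime := Fact.out
  haveI : NeZero ℓ := ⟨hℓp.ne_zero⟩
  obtain ⟨m, hm⟩ : ∃ m, ℓ = 2 * m + 1 := hℓp.odd_of_ne_two hℓ2
  have hm2 : (ℓ - 1) / 2 = m := by omega
  have h11 : (1 : ℂ) ^ 2 = 1 := one_pow 2
  -- the half system and the involution
  set H : Finset (ZMod ℓ) := (univ : Finset (ZMod ℓ)).filter (fun k ↦ 1 ≤ k.val ∧ k.val ≤ (ℓ - 1) / 2) with hH
  set ι : ZMod ℓ → ZMod ℓ := fun k ↦ ((N : ZMod ℓ) * k)⁻¹ with hι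
  set p : ZMod ℓ → ZMod ℓ := fun k ↦ if (ι k).val ≤ (ℓ - 1) / 2 then ι k else -ι k with hp
  -- basic facts
  have memH : ∀ k : ZMod ℓ, k ∈ H ↔ 1 ≤ k.val ∧ k.val ≤ m := by
    intro k; rw [hH, mem_filter, hm2]; simp
  have ne0 : ∀ {k : ZMod ℓ}, k ∈ H → k ≠ 0 := by
    intro k hk h0; rw [memH] at hk; rw [h0, ZMod.val_zero] at hk; omega
  have valpos : ∀ {x : ZMod ℓ}, x ≠ 0 → 1 ≤ x.val := fun hx ↦ Nat.one_le_iff_ne_zero.mpr ((ZMod.val_ne_zero _).mpr hx)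
  have negval : ∀ {x : ZMod ℓ}, x ≠ 0 → (-x).val = ℓ - x.val := fun hx ↦ by rw [ZMod.neg_val, if_neg hx]
  have ιne : ∀ {k : ZMod ℓ}, k ≠ 0 → ι k ≠ 0 := fun hk ↦ inv_ne_zero (mul_ne_zero hN hk)
  have ιι : ∀ k : ZMod ℓ, k ≠ 0 → ι (ι k) = k := by
    intro k hk
    simp only [hι]
    rw [mul_inv, inv_inv, ← mul_assoc, inv_mul_cancel₀ hN, one_mul]
  have ιneg : ∀ k : ZMod ℓ, ι (-k) = -ι k := by
    intro k; simp only [hι]; rw [mul_neg, inv_neg]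
  -- membership of `p k`
  have hpmem : ∀ k ∈ H, p k ∈ H := by
    intro k hk
    have hk0 := ne0 hk
    have hx0 := ιne hk0
    by_cases hle : (ι k).val ≤ (ℓ - 1) / 2
    · have : p k = ι k := by simp only [hp]; rw [if_pos hle]
      rw [this, memH]; exact ⟨valpos hx0, by omega⟩
    · have : p k = -ι k := by simp only [hp]; rw [if_neg hle]
      rw [this, memH, negval hx0]
      have := ZMod.val_lt (ι k)
      constructor <;> omega
  -- `p` is an involution on `H`
  have hpinv : ∀ k ∈ H, p (p k) = k := by
    intro k hk
    have hk0 := ne0 hk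
    have hkm : k.val ≤ (ℓ - 1) / 2 := by rw [hm2]; exact ((memH k).mp hk).2
    by_cases hle : (ι k).val ≤ (ℓ - 1) / 2
    · have h1 : p k = ι k := by simp only [hp]; rw [if_pos hle]
      rw [h1]
      simp only [hp]
      rw [ιι k hk0, if_pos hkm]
    · have h1 : p k = -ι k := by simp only [hp]; rw [if_neg hle]
      rw [h1]
      simp only [hp]
      rw [ιneg, ιι k hk0, negval hk0, neg_neg]
      have h1k : 1 ≤ k.val := ((memH k).mp hk).1
      rw [if_neg (by omega)]
  -- `μ ∘ W` is constant on orbits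
  have hw : ∀ k ∈ H, μ (minusSymbol f (((p k).val : ℚ) / ℓ)) = μ (minusSymbol f ((k.val : ℚ) / ℓ)) := by
    intro k hk
    have hk0 := ne0 hk
    have pair := minusSymbol_val_eq_mul_inv hW h11 hN hk0
    rw [one_mul] at pair
    by_cases hle : (ι k).val ≤ (ℓ - 1) / 2
    · have h1 : p k = ι k := by simp only [hp]; rw [if_pos hle]
      rw [h1, pair]
    · have h1 : p k = -ι k := by simp only [hp]; rw [if_neg hle]
      rw [h1, minusSymbol_neg_val hW h11 hN (ιne hk0), ← pair, map_neg]
      -- -μ a = μ a from 2 • μ a = 0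
      have h2 := hμ k
      rw [two_nsmul] at h2
      exact (neg_eq_of_add_eq_zero_left h2)
  -- fixed points versus `N k² = 1`
  have hfix : ∀ k ∈ H, (if p k = k then μ (minusSymbol f ((k.val : ℚ) / ℓ)) else 0) =
      (if (N : ZMod ℓ) * k * k = 1 then μ (minusSymbol f ((k.val : ℚ) / ℓ)) else 0) := by
    intro k hk
    have hk0 := ne0 hk
    have hkm : k.val ≤ (ℓ - 1) / 2 := by rw [hm2]; exact ((memH k).mp hk).2
    by_cases hsq : (N : ZMod ℓ) * k * k = 1
    · -- then ι k = k and p k = k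
      have hιk : ι k = k := inv_eq_of_mul_eq_one_right hsq
      have : p k = k := by simp only [hp]; rw [hιk, if_pos hkm]
      rw [if_pos this, if_pos hsq]
    · rw [if_neg hsq]
      by_cases hpk : p k = k
      · rw [if_pos hpk]
        -- then ι k = -k, i.e. N k² = -1, and the symbol vanishes
        have hιk : ι k = -k := by
          by_cases hle : (ι k).val ≤ (ℓ - 1) / 2
          · have h1 : p k = ι k := by simp only [hp]; rw [if_pos hle]
            rw [h1] at hpk
            have h2 : (N : ZMod ℓ) * k * k = 1 := by
              have h3 := mul_inv_cancel₀ (mul_ne_zero hN hk0)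
              rw [show ((N : ZMod ℓ) * k)⁻¹ = k from hpk] at h3
              exact h3
            exact absurd h2 hsq
          · have h1 : p k = -ι k := by simp only [hp]; rw [if_neg hle]
            rw [h1] at hpk
            exact neg_eq_iff_eq_neg.mp hpk
        have hsq' : (N : ZMod ℓ) * k * k = -1 := by
          have := mul_inv_cancel₀ (mul_ne_zero hN hk0)
          rw [show ((N : ZMod ℓ) * k)⁻¹ = ι k from rfl, hιk, mul_neg] at this
          linear_combination -this
        rw [minusSymbol_val_eq_zero_of_sq hW hN hk0 hsq', map_zero]
      · rw [if_neg hpk]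
  -- assemble
  rw [map_sum, ArchHeckePairing.sum_eq_sum_fixed H p hpmem hpinv (fun k ↦ μ (minusSymbol f ((k.val : ℚ) / ℓ))) hw
      (fun k _ ↦ hμ k)]
  have eL : ∑ k ∈ H.filter (fun k ↦ p k = k), μ (minusSymbol f ((k.val : ℚ) / ℓ)) =
      ∑ k ∈ H, (if p k = k then μ (minusSymbol f ((k.val : ℚ) / ℓ)) else 0) := Finset.sum_filter _ _
  have eR : ∑ k ∈ H.filter (fun k ↦ (N : ZMod ℓ) * k * k = 1), μ (minusSymbol f ((k.val : ℚ) / ℓ)) =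
      ∑ k ∈ H, (if (N : ZMod ℓ) * k * k = 1 then μ (minusSymbol f ((k.val : ℚ) / ℓ)) else 0) := Finset.sum_filter _ _
  rw [eL, eR]
  exact sum_congr rfl hfix

end HalfSum

/-! ## §5 Concrete form: the normalised minus symbols `[k/ℓ]⁻_f ∈ ½ℤ` and the half-sum modulo `ℤ` -/

section Concrete

variable {ℓ : ℕ} [Fact ℓ.Prime]

omit [NeZero N] in
/-- The denominator of `k.val/ℓ` is prime to `N` when `ℓ ∤ N`. [folklore] -/
theorem coprime_den_val_div (hN : (N : ZMod ℓ) ≠ 0) (k : ZMod ℓ) : Nat.Coprime (((k.val : ℚ) / ℓ).den) N := by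
  have hℓp : ℓ.Prime := Fact.out
  have hdvd : (((k.val : ℚ) / ℓ).den) ∣ ℓ := by
    have h := Rat.den_dvd (k.val : ℤ) (ℓ : ℤ)
    rw [Rat.divInt_eq_div] at h
    push_cast at h
    exact_mod_cast h
  haveI : NeZero ℓ := ⟨hℓp.ne_zero⟩
  have hℓN : Nat.Coprime ℓ N := by
    rw [Nat.Prime.coprime_iff_not_dvd hℓp]
    intro h
    exact hN ((ZMod.natCast_eq_zero_iff N ℓ).2 h)
  exact Nat.Coprime.coprime_dvd_left hdvd hℓN

/-- **`[k/ℓ]⁻_f ∈ ½ℤ`** for real-coefficient `f` and `ℓ ∤ N` (tree: `exists_normalizedMinusSymbol_eq_div_two`, the cusp `k/ℓ` being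
`Γ₀(N)`-equivalent to `0`, `im {∞,0}_f = 0`; normalisation `im Λ_f = ℤ·Ω⁻/2`) — the integrality that makes «`y` mod 2» meaningful: `y = 2[k/ℓ]⁻`.
[cite: MazurTateTeitelbaum1986Invent, §I.8] -/
theorem exists_normalizedMinusSymbol_val_eq_div_two (hreal : ∀ n, (cuspCoeff f n).im = 0) (hN : (N : ZMod ℓ) ≠ 0)
    (k : ZMod ℓ) : ∃ z : ℤ, normalizedMinusSymbol f ((k.val : ℚ) / ℓ) = (z : ℝ) / 2 :=
  exists_normalizedMinusSymbol_eq_div_two f hreal (modularSymbol_sub_zero_mem_periodLattice f (coprime_den_val_div hN k))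
    (im_modularSymbol_zero f hreal)

/-- **THE HALF-SUM MODULO `ℤ`** (`ε = 1`, real coefficients, `ℓ ∤ N` an odd prime): the half-integers `[k/ℓ]⁻_f` satisfy
`Σ_{k ∈ H} [k/ℓ]⁻_f ≡ Σ_{k ∈ H, N k² = 1} [k/ℓ]⁻_f (mod ℤ)`, `H = {1 ≤ k.val ≤ (ℓ−1)/2}` — equivalently the INTEGERS `y = 2[k/ℓ]⁻` satisfy
`Σ_{k<ℓ/2} y(k/ℓ) ≡ y(s/ℓ)·[N s² ≡ 1 solvable] (mod 2)`: memo §8.3's `H_ℓ ≡ y(s/ℓ)·[(N/ℓ) = +1]`, now a tree theorem.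
[cite: MazurTateTeitelbaum1986Invent, §I.17] [cite: Cremona1997, §2.8] -/
theorem halfSum_normalizedMinusSymbol_congr (hW : IsFrickeEigen N f 1) (hreal : ∀ n, (cuspCoeff f n).im = 0)
    (hN : (N : ZMod ℓ) ≠ 0) (hℓ2 : ℓ ≠ 2) :
    ∃ z : ℤ, (∑ k ∈ (univ : Finset (ZMod ℓ)).filter (fun k ↦ 1 ≤ k.val ∧ k.val ≤ (ℓ - 1) / 2),
        normalizedMinusSymbol f ((k.val : ℚ) / ℓ)) -
      (∑ k ∈ ((univ : Finset (ZMod ℓ)).filter (fun k ↦ 1 ≤ k.val ∧ k.val ≤ (ℓ - 1) / 2)).filter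
          (fun k ↦ (N : ZMod ℓ) * k * k = 1), normalizedMinusSymbol f ((k.val : ℚ) / ℓ)) = z := by
  classical
  set Ω : ℝ := minusPeriod f with hΩ
  set μ : ℂ →+ ℝ ⧸ AddSubgroup.zmultiples (1 : ℝ) :=
    (QuotientAddGroup.mk' (AddSubgroup.zmultiples (1 : ℝ))).comp
      ((AddMonoidHom.mulLeft Ω⁻¹).comp Complex.imAddGroupHom) with hμ
  have hμapply : ∀ z : ℂ, μ z = QuotientAddGroup.mk' (AddSubgroup.zmultiples (1 : ℝ)) (Ω⁻¹ * z.im) := by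
    intro z; rfl
  have hnorm : ∀ r : ℚ, Ω⁻¹ * (minusSymbol f r).im = normalizedMinusSymbol f r := by
    intro r; rw [normalizedMinusSymbol, hΩ, div_eq_inv_mul]
  -- `2 • μ (W k) = 0` from `[k/ℓ]⁻ ∈ ½ℤ`
  have h2 : ∀ k : ZMod ℓ, 2 • μ (minusSymbol f ((k.val : ℚ) / ℓ)) = 0 := by
    intro k
    obtain ⟨z, hz⟩ := exists_normalizedMinusSymbol_val_eq_div_two hreal hN k
    rw [hμapply, hnorm, hz, ← map_nsmul, QuotientAddGroup.mk'_apply, QuotientAddGroup.eq_zero_iff,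
      AddSubgroup.mem_zmultiples_iff]
    exact ⟨z, by rw [nsmul_eq_mul]; push_cast; ring⟩
  have main := halfSum_eq_sum_sq hW hN hℓ2 μ h2
  rw [← map_sum] at main
  have hdiff : μ ((∑ k ∈ (univ : Finset (ZMod ℓ)).filter (fun k ↦ 1 ≤ k.val ∧ k.val ≤ (ℓ - 1) / 2),
        minusSymbol f ((k.val : ℚ) / ℓ)) -
      ∑ k ∈ ((univ : Finset (ZMod ℓ)).filter (fun k ↦ 1 ≤ k.val ∧ k.val ≤ (ℓ - 1) / 2)).filter
          (fun k ↦ (N : ZMod ℓ) * k * k = 1), minusSymbol f ((k.val : ℚ) / ℓ)) = 0 := by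
    rw [map_sub, main, sub_self]
  rw [hμapply, QuotientAddGroup.mk'_apply, QuotientAddGroup.eq_zero_iff, AddSubgroup.mem_zmultiples_iff] at hdiff
  obtain ⟨z, hz⟩ := hdiff
  refine ⟨z, ?_⟩
  rw [Complex.sub_im, Complex.im_sum, Complex.im_sum, mul_sub, Finset.mul_sum, Finset.mul_sum] at hz
  simp only [hnorm] at hz
  rw [← hz, zsmul_eq_mul, mul_one]

end Concrete

end Summit.BirchSwinnertonDyer.BirchSwinnertonDyer.Theorems.OffBigImageOddLocalAtTwo.ArchFrickeHalfSum

end
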